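import Literature.MathematicalPhysics.QuantumFieldTheory.BalabanImbrieJaffe1984to88.BIJ88RT52Restrictions
import Literature.MathematicalPhysics.QuantumFieldTheory.BalabanImbrieJaffe1984to88.BIJ88Eq531TranslLaw

/-!
# `BalabanImbrieJaffe1984to88.BIJ88RT53DensityForm` — T. Bałaban, J. Imbrie, A. Jaffe, *Effective action and cluster properties of the
abelian Higgs model*, Commun. Math. Phys. **114** (1988) 257–315 [BalabanImbrieJaffe1988], (5.3.1)/(5.3.6) p. 280 [PDF 24] applied to the
density display of (5.1.1)/(5.2.8) pp. 277–279, and the form of the result, first line of (5.9.6) p. 297 [PDF 41] / pp. 313–314 [PDF 57–58] *"which is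
in the form of our original induction hypothesis, (4.1)"*: **THE RENORMALIZED DENSITY AS AN ORDINARY INTEGRAL OVER THE LEVEL-`k` FIELDS.**
File 1 of this seat (`BIJ88RT52Restrictions`) characterizes `ρ̃(v, ψ)` by the push-forward display `IsRD ν terms Qu Qφ a ρ` — the measure-level
reading of *"∫ν(du) δ(v/Qu) ∫Π𝒟u^{(j)} ∫𝒟φ (…)"* with a `ψ`-dependent integrand (the shape of (5.2.8)).  Here it is PROVED that after the gauge
field translation `u = u′·(Q^{s*}v)` of (5.3.1) carried out over the whole lattice (the setting of [2] chapter 6, p. 280: *"where the effects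
of the translations are followed without the complications of the large field regions"*), EVERY `dv dψ`-integrable solution `ρ̃` is, `dv dψ`-almost
everywhere, the honest integral `ρ̃(v, ψ) = Σ_t ∫ν(du) ∫Π𝒟u^{(j)} ∫𝒟φ ρ_t({u^{(j)}}, u′(u)·Q^{s*}v, φ, ψ)·e^{−½aL⁻²‖ψ − Q_t(…)‖² − E}` — *"it removes the
v-field from the δ-functions"* — and, for `ν = 𝒟u`, that this IS the inductive form (4.1) at level `k + 1`: an integral over
`Π_{j=0}^{k} 𝒟u^{(j)}` (r18's `prevMeasure P (k+1)`, the fine field `u` becoming the `k`-th previous field `u^{(k)}`) of an explicit `ρ′_{k+1}`.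
(File 6 of seat p34 gen 8; the (5.1.1)-without-`ψ` case for the CONSTRUCTED density is gen 7's `BIJ88Eq531TranslDensity.rt51_ae_eq_transl`;
here: any solution, `ψ`-dependent integrands, and the (4.1) repackaging.)

statement-level skeleton of published theorems with citation tags; proofs where landed; nothing here is a claim about the Yang–Mills mass gap

PDF held: `paper:balaban1988-cmp114-bij-abelian-higgs-effective-action` (journal page = PDF page + 256); pp. 273–274, 277–281, 297, 313–314 [PDF 17–18,
21–25, 41, 57–58] read (`lit read … --pages 17-25`; r16's renders `HOME/lit-balaban-r16/renders/cmp114/original-p0NN-x2.png`).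

CITATION HEADER (lean-in-tree rule).  Part of the lit-balaban TYPED SKELETON (HOME `run/shared/lean/pub/lit-balaban/`), PHASE-2 proof seat
p34 gen 8 (unit `lit-balaban-p34-g8`; TAKING line HOME/STATUS.md 2026-08-21T19:5xZ; own lineage = the C1/C2 renormalization-transformation line).
Rows served (support): `C2.Eq5.3.1-5.3.7`, `C2.Eq5.9.6` (first line), `C2.Claim@313` (the (4.1)-form at `k + 1`, in the no-large-field setting)
of `HOME/lit-balaban-r16/ROWS-C2-part2.md` (owner r16); `C2.Eq4.1` of `HOME/lit-balaban-r18/ROWS-C2.md` (owner r18).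

THE PRINTED TEXT (verbatim).  p. 280 [PDF 24]: *"The first translation is done in Λ₁^{(k)*}, and it removes the v-field from the δ-functions
there. As in (3.24) we put u = u′(Λ₁^{(k)*}Q^{s*}v), (5.3.1) … δ_{Ax}(u) = δ_{Ax}(u′), δ(v/Qu) = δ_{Λ₁^{(k)′*c}}(v/Qu) δ_{Λ₁^{(k)′*}}((e_k/2π)QA′),
(5.3.6)"*.  p. 297 [PDF 41], first line of (5.9.6): *"ρ^L_{k+1}(v, ψ) = Σ_{{X_ω}} Σ_{Λ₀^{(k)}} ∫du^{(k)}dφ^{(k)} δ_{Ax}(u^{(k)}) δ_{Λ₁^{(k)′*c}}(v/Qu^{(k)})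
δ_{Λ₁^{(k)′*}}((e_k/2π)QA^{(k)}) ∫Π_{j=0}^{k−1}du^{(j)}|… (…)"* (the fine fields renamed `u^{(k)}, φ^{(k)}`).  pp. 313–314 [PDF 57–58] (the display
starts at the foot of p. 313, the sentence is the first line of p. 314): *"ρ_{k+1}(v, ψ) =
Σ_{{X_{ω′}}} ∫Π_{j=0}^{k} du^{(j)}|_{Λ₁₀^{(j)c*}} ρ′_{k+1}(v, ψ, {X_{ω′}}, {u^{(j)}}), which is in the form of our original induction hypothesis, (4.1)"*.

THE READING (carriers of record; nothing re-declared).  `ν` = the law of the fine gauge field in the display (`𝒟u δ_{Ax}` = r18's `axialMeasure`,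
or `𝒟u` = `fieldMeasure`), assumed a probability law invariant under the substitutions `u ↦ u·Q^{s*}w` (gen 7's `axialMeasure_map_surfMul`, r18's
`map_surfMul_fieldMeasure`) — the only property used; `u′ = uPrime u`, `u·Q^{s*}w = surfMul u w`, `Qu = qU` ([2] (2.10)/(2.15), r18); the term
data `(ρ_t, Q_t)` and `gaussWeight` as in file 1; `Π_{j<k}𝒟u^{(j)}` = `prevMeasure P k`, and `Π_{j≤k}𝒟u^{(j)}` = `prevMeasure P (k+1)` with
`{u^{(j)}}_{j≤k} = Fin.snoc {u^{(j)}}_{j<k} u^{(k)}` (`Fin.init`, `· (Fin.last k)` recover the parts).  NO LARGE-FIELD REGIONS: the translation region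
is the whole block lattice (with a cut-off `Λ ≠ T` the factor `δ_{Λᶜ}(v/Qu)` survives and `ρ̃` is not a plain fibre integral — file 4's `IsRDT`).

WHAT IS PROVED (kernel-checked; theorems only, no `def`, no `Prop`-valued fact; standard axioms).
* §1 plumbing: the reshuffle-and-translate map `Ξ : ((v, ψ), (u, {u^{(j)}}, φ)) ↦ (u′(u)·Q^{s*}v, {u^{(j)}}, φ, ψ)` carries `(dv ⊗ dψ) ⊗ (ν ⊗ Π𝒟u^{(j)} ⊗
  𝒟φ)` onto file 1's `fieldsMeasure ν` (`measurePreserving_transl₅`; gen 7's `measurePreserving_transl` and coordinate shuffles);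
  `measurePreserving_snoc` / `integral_prevMeasure_succ` (`Π_{j≤k}𝒟u^{(j)} = 𝒟u^{(k)} ⊗ Π_{j<k}𝒟u^{(j)}` along `Fin.snoc`); a three-fold Fubini.
* §2 **`isRD_ae_eq_transl`**: `IsRD ν terms qU Qφ a ρ ρ̃`, integrable term integrands, `ρ̃` `dv dψ`-integrable ⟹ `ρ̃ =ᵐ (v, ψ) ↦ Σ_t ∫ ρ_t({u^{(j)}},
  u′(u)·Q^{s*}v, φ, ψ)·gaussWeight a (Q_t({u^{(j)}}, u′(u)·Q^{s*}v, φ)) ψ d(ν ⊗ Π𝒟u^{(j)} ⊗ 𝒟φ)` (both sides integrate every bounded measurable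
  test function equally — the measure-preserving `Ξ` and `Q(u′·Q^{s*}v) = v` — and gen 5's uniqueness `ae_eq_of_forall_test`); the iterated
  form `isRD_ae_eq_transl_iter` (`∫ν(du)∫Π𝒟u^{(j)}∫𝒟φ`, a.e.); instances `_axial` (`𝒟u δ_{Ax}`: the first line of (5.9.6) without large fields)
  and `_field` (`𝒟u`).
* §3 **`isRD_field_ae_eq_form41`** — *"in the form of our original induction hypothesis, (4.1)"* at level `k + 1`, no large fields: for
  `ν = 𝒟u`, `ρ̃(v, ψ) =ᵐ Σ_t ∫_{Π_{j≤k}𝒟u^{(j)}} ρ′_{k+1,t}({u^{(j)}}_{j≤k}; v, ψ)` with the EXPLICIT `ρ′_{k+1,t} = ∫𝒟φ^{(k)} ρ_t({u^{(j)}}_{j<k},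
  u^{(k)′}·Q^{s*}v, φ^{(k)}, ψ)·gaussWeight a (Q_t(…)) ψ`, the integral being over r18's `prevMeasure P (k+1)`.
NOT DONE HERE (honest scope).  Large-field regions / cut-offs (file 4), the `A′`-variables and the Jacobian `(e_k/2π)` of (5.3.6)–(5.3.7) (p31's
`BIJ88Eq536Linearization`/`BIJ88Eq537Jacobian`), the later operations of §§5.4–5.15 entering `ρ′_{k+1}` of p. 313; any bound.  Imports file 1 and
gen 7's `BIJ88Eq531TranslLaw` (Literature + Mathlib only).

v1.1 (p34 gen 9, docstrings only): locator correction of ref-1 g39 (2026-08-21T20:23Z) — the sentence *"which is in the form of our original induction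
hypothesis, (4.1)"* is the first line of p. 314 [PDF 58], the display starting at the foot of p. 313 [PDF 57]; `p. 313` ↦ `pp. 313–314` in the header and
in the docstring of `isRD_field_ae_eq_form41`.  No declaration, statement or proof is changed.
-/

namespace Literature.MathematicalPhysics.QuantumFieldTheory.BalabanImbrieJaffe1984to88.BIJ88RT53DensityForm

open Literature.MathematicalPhysics.QuantumFieldTheory.Balaban1983to89
open BIJ88Sect3Statements (U1)
open BIJ85Sect1Model (HiggsField)
open BIJ88RenormTransf311 (axialMeasure gaussWeight)
open BIJ88InductiveForm41 (Prev prevMeasure)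
open BIJ85BlockAveragesTorus (qU surfMul uPrime measurable_qU map_surfMul_fieldMeasure)
open BIJ88Eq531TranslLaw (qU_surfMul_uPrime axialMeasure_map_surfMul measurePreserving_transl)
open BIJ88RT52Restrictions (Fields fieldsMeasure IsRD integral_fieldsMeasure)
open BIJ88RT51Unique (ae_eq_of_forall_test)
open scoped BigOperators ENNReal
open _root_.MeasureTheory _root_.MeasureTheory.Measure Complex Function

noncomputable section

variable {P : Params} {k : ℕ}

/-! ## §1 Plumbing: the reshuffle-and-translate map, `Fin.snoc`, a three-fold Fubini -/

section Plumbing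

variable {ν : Measure (GaugeField P k U1)} [IsProbabilityMeasure ν]

/-- kernel: the coordinate shuffle `((v, ψ), (u, ({u^{(j)}}, φ))) ↦ ((u, v), ({u^{(j)}}, (φ, ψ)))` preserves the product measures (swaps and
re-associations of finitely many σ-finite factors). [folklore] -/
private theorem measurePreserving_shuffle₅ :
    MeasurePreserving
      (fun r : (GaugeField P (k+1) U1 × HiggsField P (k+1)) × (GaugeField P k U1 × (Prev P k × HiggsField P k)) =>
        ((r.2.1, r.1.1), (r.2.2.1, (r.2.2.2, r.1.2))))
      (((fieldMeasure P (k+1) U1).prod (volume : Measure (HiggsField P (k+1)))).prod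
        (ν.prod ((prevMeasure P k).prod (volume : Measure (HiggsField P k)))))
      ((ν.prod (fieldMeasure P (k+1) U1)).prod
        ((prevMeasure P k).prod ((volume : Measure (HiggsField P k)).prod (volume : Measure (HiggsField P (k+1)))))) := by
  -- notation for the factors
  set dv : Measure (GaugeField P (k+1) U1) := fieldMeasure P (k+1) U1
  set dψ : Measure (HiggsField P (k+1)) := volume
  set dp : Measure (Prev P k) := prevMeasure P k
  set dφ : Measure (HiggsField P k) := volume
  -- g : (ψ, (p, φ)) ↦ (p, (φ, ψ))
  have g1 : MeasurePreserving (Prod.swap : HiggsField P (k+1) × (Prev P k × HiggsField P k) → (Prev P k × HiggsField P k) × HiggsField P (k+1))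
      (dψ.prod (dp.prod dφ)) ((dp.prod dφ).prod dψ) := measurePreserving_swap
  have g2 : MeasurePreserving (MeasurableEquiv.prodAssoc : (Prev P k × HiggsField P k) × HiggsField P (k+1) → Prev P k × (HiggsField P k ×
      HiggsField P (k+1))) ((dp.prod dφ).prod dψ) (dp.prod (dφ.prod dψ)) := measurePreserving_prodAssoc dp dφ dψ
  have hg := g2.comp g1
  -- f : ((p, φ), (v, ψ)) ↦ (v, (p, (φ, ψ)))
  have f1 : MeasurePreserving (Prod.swap : (Prev P k × HiggsField P k) × (GaugeField P (k+1) U1 × HiggsField P (k+1)) →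
      (GaugeField P (k+1) U1 × HiggsField P (k+1)) × (Prev P k × HiggsField P k)) ((dp.prod dφ).prod (dv.prod dψ)) ((dv.prod dψ).prod (dp.prod dφ)) :=
    measurePreserving_swap
  have f2 : MeasurePreserving (MeasurableEquiv.prodAssoc : (GaugeField P (k+1) U1 × HiggsField P (k+1)) × (Prev P k × HiggsField P k) →
      GaugeField P (k+1) U1 × (HiggsField P (k+1) × (Prev P k × HiggsField P k))) ((dv.prod dψ).prod (dp.prod dφ)) (dv.prod (dψ.prod (dp.prod dφ))) :=
    measurePreserving_prodAssoc dv dψ (dp.prod dφ)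
  have f3 : MeasurePreserving (Prod.map (id : GaugeField P (k+1) U1 → GaugeField P (k+1) U1)
      ((MeasurableEquiv.prodAssoc : (Prev P k × HiggsField P k) × HiggsField P (k+1) → _) ∘
        (Prod.swap : HiggsField P (k+1) × (Prev P k × HiggsField P k) → _)))
      (dv.prod (dψ.prod (dp.prod dφ))) (dv.prod (dp.prod (dφ.prod dψ))) := (MeasurePreserving.id dv).prod hg
  have hf := f3.comp (f2.comp f1)
  -- the whole shuffle
  have m1 : MeasurePreserving (Prod.swap : (GaugeField P (k+1) U1 × HiggsField P (k+1)) × (GaugeField P k U1 × (Prev P k × HiggsField P k)) →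
      (GaugeField P k U1 × (Prev P k × HiggsField P k)) × (GaugeField P (k+1) U1 × HiggsField P (k+1)))
      (((dv.prod dψ).prod (ν.prod (dp.prod dφ)))) ((ν.prod (dp.prod dφ)).prod (dv.prod dψ)) := measurePreserving_swap
  have m2 : MeasurePreserving (MeasurableEquiv.prodAssoc : (GaugeField P k U1 × (Prev P k × HiggsField P k)) × (GaugeField P (k+1) U1 ×
      HiggsField P (k+1)) → GaugeField P k U1 × ((Prev P k × HiggsField P k) × (GaugeField P (k+1) U1 × HiggsField P (k+1))))
      ((ν.prod (dp.prod dφ)).prod (dv.prod dψ)) (ν.prod ((dp.prod dφ).prod (dv.prod dψ))) := measurePreserving_prodAssoc ν (dp.prod dφ) (dv.prod dψ)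
  have m3 : MeasurePreserving (Prod.map (id : GaugeField P k U1 → GaugeField P k U1)
      ((Prod.map (id : GaugeField P (k+1) U1 → GaugeField P (k+1) U1)
          ((MeasurableEquiv.prodAssoc : (Prev P k × HiggsField P k) × HiggsField P (k+1) → _) ∘
            (Prod.swap : HiggsField P (k+1) × (Prev P k × HiggsField P k) → _))) ∘
        (MeasurableEquiv.prodAssoc : (GaugeField P (k+1) U1 × HiggsField P (k+1)) × (Prev P k × HiggsField P k) → _) ∘
        (Prod.swap : (Prev P k × HiggsField P k) × (GaugeField P (k+1) U1 × HiggsField P (k+1)) → _)))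
      (ν.prod ((dp.prod dφ).prod (dv.prod dψ))) (ν.prod (dv.prod (dp.prod (dφ.prod dψ)))) := (MeasurePreserving.id ν).prod hf
  have m4 : MeasurePreserving (MeasurableEquiv.prodAssoc.symm : GaugeField P k U1 × (GaugeField P (k+1) U1 × (Prev P k × (HiggsField P k ×
      HiggsField P (k+1)))) → (GaugeField P k U1 × GaugeField P (k+1) U1) × (Prev P k × (HiggsField P k × HiggsField P (k+1))))
      (ν.prod (dv.prod (dp.prod (dφ.prod dψ)))) ((ν.prod dv).prod (dp.prod (dφ.prod dψ))) :=
    MeasurePreserving.symm MeasurableEquiv.prodAssoc (measurePreserving_prodAssoc ν dv (dp.prod (dφ.prod dψ)))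
  have e : (fun r : (GaugeField P (k+1) U1 × HiggsField P (k+1)) × (GaugeField P k U1 × (Prev P k × HiggsField P k)) =>
        ((r.2.1, r.1.1), (r.2.2.1, (r.2.2.2, r.1.2)))) =
      (MeasurableEquiv.prodAssoc.symm : GaugeField P k U1 × (GaugeField P (k+1) U1 × (Prev P k × (HiggsField P k × HiggsField P (k+1)))) → _) ∘
      (Prod.map (id : GaugeField P k U1 → GaugeField P k U1)
        ((Prod.map (id : GaugeField P (k+1) U1 → GaugeField P (k+1) U1)
            ((MeasurableEquiv.prodAssoc : (Prev P k × HiggsField P k) × HiggsField P (k+1) → _) ∘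
              (Prod.swap : HiggsField P (k+1) × (Prev P k × HiggsField P k) → _))) ∘
          (MeasurableEquiv.prodAssoc : (GaugeField P (k+1) U1 × HiggsField P (k+1)) × (Prev P k × HiggsField P k) → _) ∘
          (Prod.swap : (Prev P k × HiggsField P k) × (GaugeField P (k+1) U1 × HiggsField P (k+1)) → _))) ∘
      (MeasurableEquiv.prodAssoc : (GaugeField P k U1 × (Prev P k × HiggsField P k)) × (GaugeField P (k+1) U1 × HiggsField P (k+1)) → _) ∘
      (Prod.swap : (GaugeField P (k+1) U1 × HiggsField P (k+1)) × (GaugeField P k U1 × (Prev P k × HiggsField P k)) → _) := by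
    funext r
    rfl
  rw [e]
  exact m4.comp (m3.comp (m2.comp m1))

/-- kernel: **the reshuffle-and-translate map** `Ξ : ((v, ψ), (u, {u^{(j)}}, φ)) ↦ (u′(u)·Q^{s*}v, {u^{(j)}}, φ, ψ)` carries `(dv ⊗ dψ) ⊗ (ν ⊗ Π𝒟u^{(j)} ⊗
𝒟φ)` onto file 1's `fieldsMeasure ν = ν ⊗ Π𝒟u^{(j)} ⊗ 𝒟φ ⊗ dψ`, for every substitution-invariant probability law `ν` (gen 7's `measurePreserving_transl`
on the pair `(u, v)`, the identity on the spectators; standing range). [cite: BalabanImbrieJaffe1988, (5.3.1) p.280] -/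
theorem measurePreserving_transl₅ (hk : k + 1 ≤ P.m + P.K) (hν : ∀ w, ν.map (fun U => surfMul U w) = ν) :
    MeasurePreserving
      (fun r : (GaugeField P (k+1) U1 × HiggsField P (k+1)) × (GaugeField P k U1 × (Prev P k × HiggsField P k)) =>
        ((surfMul (uPrime r.2.1) r.1.1, (r.2.2.1, (r.2.2.2, r.1.2))) : Fields P k))
      (((fieldMeasure P (k+1) U1).prod (volume : Measure (HiggsField P (k+1)))).prod
        (ν.prod ((prevMeasure P k).prod (volume : Measure (HiggsField P k)))))
      (fieldsMeasure ν) := by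
  have hT : MeasurePreserving
      (Prod.map (fun p : GaugeField P k U1 × GaugeField P (k+1) U1 => surfMul (uPrime p.1) p.2)
        (id : Prev P k × (HiggsField P k × HiggsField P (k+1)) → _))
      ((ν.prod (fieldMeasure P (k+1) U1)).prod
        ((prevMeasure P k).prod ((volume : Measure (HiggsField P k)).prod (volume : Measure (HiggsField P (k+1))))))
      (fieldsMeasure ν) := by
    unfold fieldsMeasure
    exact (measurePreserving_transl hk hν).prod (MeasurePreserving.id _)
  have e : (fun r : (GaugeField P (k+1) U1 × HiggsField P (k+1)) × (GaugeField P k U1 × (Prev P k × HiggsField P k)) =>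
        ((surfMul (uPrime r.2.1) r.1.1, (r.2.2.1, (r.2.2.2, r.1.2))) : Fields P k)) =
      (Prod.map (fun p : GaugeField P k U1 × GaugeField P (k+1) U1 => surfMul (uPrime p.1) p.2)
        (id : Prev P k × (HiggsField P k × HiggsField P (k+1)) → _)) ∘
      (fun r : (GaugeField P (k+1) U1 × HiggsField P (k+1)) × (GaugeField P k U1 × (Prev P k × HiggsField P k)) =>
        ((r.2.1, r.1.1), (r.2.2.1, (r.2.2.2, r.1.2)))) := by
    funext r
    rfl
  rw [e]
  exact hT.comp measurePreserving_shuffle₅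

omit [IsProbabilityMeasure ν] in
/-- kernel: three-fold Fubini — the integral of an integrable function over `ν ⊗ (Π𝒟u^{(j)} ⊗ 𝒟φ)` is the iterated integral (almost everywhere at
the middle level). [folklore] -/
private theorem integral_prod₃ [SFinite ν] {E : Type*} [NormedAddCommGroup E] [NormedSpace ℝ E]
    {F : GaugeField P k U1 × (Prev P k × HiggsField P k) → E}
    (hF : Integrable F (ν.prod ((prevMeasure P k).prod (volume : Measure (HiggsField P k))))) :
    ∫ q, F q ∂ν.prod ((prevMeasure P k).prod (volume : Measure (HiggsField P k))) =
      ∫ U, ∫ prev, ∫ φ, F (U, (prev, φ)) ∂volume ∂prevMeasure P k ∂ν := by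
  rw [integral_prod _ hF]
  refine integral_congr_ae ?_
  filter_upwards [hF.prod_right_ae] with U hU
  rw [integral_prod _ hU]

/-- kernel: `{u^{(j)}}_{j≤k} = Fin.snoc {u^{(j)}}_{j<k} u^{(k)}` is measurable in the pair. [folklore] -/
private theorem measurable_snoc :
    Measurable fun p : GaugeField P k U1 × Prev P k => (Fin.snoc p.2 p.1 : Prev P (k+1)) := by
  refine measurable_pi_iff.mpr fun i => ?_
  induction i using Fin.lastCases with
  | last =>
    simp only [Fin.snoc_last]
    exact measurable_fst
  | cast j =>
    simp only [Fin.snoc_castSucc]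
    exact (measurable_pi_apply j).comp measurable_snd

/-- kernel: **`Π_{j≤k} 𝒟u^{(j)} = 𝒟u^{(k)} ⊗ Π_{j<k} 𝒟u^{(j)}` along `Fin.snoc`** — appending the fine field as the `k`-th previous field carries
`𝒟u ⊗ Π_{j<k}𝒟u^{(j)}` onto r18's `prevMeasure P (k+1)` (product measures agree on boxes; `Fin.prod_univ_castSucc`).
[cite: BalabanImbrieJaffe1988, (4.1) p.274] -/
theorem measurePreserving_snoc :
    MeasurePreserving (fun p : GaugeField P k U1 × Prev P k => (Fin.snoc p.2 p.1 : Prev P (k+1)))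
      ((fieldMeasure P k U1).prod (prevMeasure P k)) (prevMeasure P (k+1)) := by
  refine ⟨measurable_snoc, ?_⟩
  unfold prevMeasure
  symm
  refine Measure.pi_eq fun s hs => ?_
  rw [Measure.map_apply measurable_snoc (MeasurableSet.univ_pi hs)]
  -- the box pulls back to a product of a box and a box (typed on the carriers of record)
  set A : Set (GaugeField P k U1) := s (Fin.last k) with hA
  set B : (j : Fin k) → Set (GaugeField P j U1) := fun j => s (Fin.castSucc j) with hB
  have hpre : (fun p : GaugeField P k U1 × Prev P k => (Fin.snoc p.2 p.1 : Prev P (k+1))) ⁻¹' Set.pi Set.univ s =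
      A ×ˢ Set.pi Set.univ B := by
    ext p
    rw [Set.mem_preimage, Set.mem_univ_pi, Set.mem_prod, Set.mem_univ_pi]
    constructor
    · intro h
      refine ⟨?_, fun j => ?_⟩
      · have h1 := h (Fin.last k)
        simp only [Fin.snoc_last] at h1
        exact h1
      · have h1 := h (Fin.castSucc j)
        simp only [Fin.snoc_castSucc] at h1
        exact h1
    · rintro ⟨h1, h2⟩ i
      induction i using Fin.lastCases with
      | last =>
        simp only [Fin.snoc_last]
        exact h1
      | cast j =>
        simp only [Fin.snoc_castSucc]
        exact h2 j
  rw [hpre, Measure.prod_prod, Measure.pi_pi, Fin.prod_univ_castSucc, mul_comm]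
  rfl

/-- **`∫_{Π_{j≤k}𝒟u^{(j)}} F = ∫𝒟u^{(k)} ∫_{Π_{j<k}𝒟u^{(j)}} F(Fin.snoc {u^{(j)}} u^{(k)})`** for every integrable `F` (the measure-preserving `Fin.snoc`
and Fubini). [cite: BalabanImbrieJaffe1988, (4.1) p.274] -/
theorem integral_prevMeasure_succ {E : Type*} [NormedAddCommGroup E] [NormedSpace ℝ E] {F : Prev P (k+1) → E}
    (hF : Integrable F (prevMeasure P (k+1))) :
    ∫ q, F q ∂prevMeasure P (k+1) = ∫ U, ∫ prev, F (Fin.snoc prev U) ∂prevMeasure P k ∂fieldMeasure P k U1 := by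
  have hS := (measurePreserving_snoc (P := P) (k := k))
  have hm : AEStronglyMeasurable F (Measure.map (fun p : GaugeField P k U1 × Prev P k => (Fin.snoc p.2 p.1 : Prev P (k+1)))
      ((fieldMeasure P k U1).prod (prevMeasure P k))) := by
    rw [hS.map_eq]
    exact hF.aestronglyMeasurable
  have hI : Integrable (fun p : GaugeField P k U1 × Prev P k => F (Fin.snoc p.2 p.1)) ((fieldMeasure P k U1).prod (prevMeasure P k)) :=
    (hS.integrable_comp hF.aestronglyMeasurable).2 hF
  rw [← hS.map_eq, integral_map hS.measurable.aemeasurable hm, integral_prod _ hI]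

end Plumbing

/-! ## §2 The density after the translation over the whole lattice: an ordinary fibre integral -/

section Transl

variable {ι : Type*} {terms : Finset ι} {ν : Measure (GaugeField P k U1)} [IsProbabilityMeasure ν]
variable {Qφ : ι → Prev P k → GaugeField P k U1 → HiggsField P k → HiggsField P (k+1)} {a : ℝ}
variable {ρ : ι → Prev P k → GaugeField P k U1 → HiggsField P k → HiggsField P (k+1) → ℂ}
variable {ρL : GaugeField P (k+1) U1 → HiggsField P (k+1) → ℂ}

/-- kernel: **one term of the display, tested, after the translation** — `∫ν∫Π𝒟u^{(j)}∫𝒟φ∫dψ ρ_t·gaussWeight·g(Qu, ψ) = ∫dv dψ [∫ ρ_t({u^{(j)}},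
u′(u)·Q^{s*}v, φ, ψ)·gaussWeight d(ν ⊗ Π𝒟u^{(j)} ⊗ 𝒟φ)] g(v, ψ)` for bounded measurable `g` (`measurePreserving_transl₅`, `Q(u′·Q^{s*}v) = v`, Fubini;
standing range). [cite: BalabanImbrieJaffe1988, (5.3.1) p.280] -/
theorem term_test_eq_transl (hk : k + 1 ≤ P.m + P.K) (hν : ∀ w, ν.map (fun U => surfMul U w) = ν) {t : ι}
    (hρi : Integrable
      (fun q : Fields P k => ρ t q.2.1 q.1 q.2.2.1 q.2.2.2 * (gaussWeight a (Qφ t q.2.1 q.1 q.2.2.1) q.2.2.2 : ℂ)) (fieldsMeasure ν))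
    {g : GaugeField P (k+1) U1 × HiggsField P (k+1) → ℂ} (hg : Measurable g) {C : ℝ} (hC : ∀ z, ‖g z‖ ≤ C) :
    ∫ U, ∫ prev, ∫ φ, ∫ ψ, ρ t prev U φ ψ * (gaussWeight a (Qφ t prev U φ) ψ : ℂ) * g (qU U, ψ) ∂volume ∂volume ∂prevMeasure P k ∂ν =
      ∫ v, ∫ ψ, (∫ q, ρ t q.2.1 (surfMul (uPrime q.1) v) q.2.2 ψ *
          (gaussWeight a (Qφ t q.2.1 (surfMul (uPrime q.1) v) q.2.2) ψ : ℂ) ∂ν.prod ((prevMeasure P k).prod volume)) * g (v, ψ)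
        ∂volume ∂fieldMeasure P (k+1) U1 := by
  -- the full integrand on `Fields P k`
  set K : Fields P k → ℂ := fun q =>
    ρ t q.2.1 q.1 q.2.2.1 q.2.2.2 * (gaussWeight a (Qφ t q.2.1 q.1 q.2.2.1) q.2.2.2 : ℂ) with hKdef
  have hgm : Measurable fun q : Fields P k => g (qU q.1, q.2.2.2) :=
    hg.comp ((measurable_qU.comp measurable_fst).prodMk (measurable_snd.comp (measurable_snd.comp measurable_snd)))
  have hKg : Integrable (fun q : Fields P k => K q * g (qU q.1, q.2.2.2)) (fieldsMeasure ν) :=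
    hρi.mul_bdd hgm.aestronglyMeasurable (Filter.Eventually.of_forall fun q => hC _)
  have hΞ := measurePreserving_transl₅ (P := P) (k := k) hk hν
  -- the pulled-back integrand
  have hKΞ : Integrable (fun r : (GaugeField P (k+1) U1 × HiggsField P (k+1)) × (GaugeField P k U1 × (Prev P k × HiggsField P k)) =>
      K (surfMul (uPrime r.2.1) r.1.1, (r.2.2.1, (r.2.2.2, r.1.2))))
      (((fieldMeasure P (k+1) U1).prod volume).prod (ν.prod ((prevMeasure P k).prod volume))) :=
    (hΞ.integrable_comp hρi.aestronglyMeasurable).2 hρi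
  have hKΞg : Integrable (fun r : (GaugeField P (k+1) U1 × HiggsField P (k+1)) × (GaugeField P k U1 × (Prev P k × HiggsField P k)) =>
      K (surfMul (uPrime r.2.1) r.1.1, (r.2.2.1, (r.2.2.2, r.1.2))) * g r.1)
      (((fieldMeasure P (k+1) U1).prod volume).prod (ν.prod ((prevMeasure P k).prod volume))) :=
    hKΞ.mul_bdd ((hg.comp measurable_fst).aestronglyMeasurable) (Filter.Eventually.of_forall fun r => hC _)
  -- LHS as one integral over `fieldsMeasure ν`, then pulled back along `Ξ`
  have lhs : ∫ U, ∫ prev, ∫ φ, ∫ ψ, ρ t prev U φ ψ * (gaussWeight a (Qφ t prev U φ) ψ : ℂ) * g (qU U, ψ)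
      ∂volume ∂volume ∂prevMeasure P k ∂ν = ∫ q, K q * g (qU q.1, q.2.2.2) ∂fieldsMeasure ν := by
    rw [integral_fieldsMeasure hKg]
  have pull : ∫ q, K q * g (qU q.1, q.2.2.2) ∂fieldsMeasure ν =
      ∫ r, K (surfMul (uPrime r.2.1) r.1.1, (r.2.2.1, (r.2.2.2, r.1.2))) * g r.1
        ∂((fieldMeasure P (k+1) U1).prod volume).prod (ν.prod ((prevMeasure P k).prod volume)) := by
    have hm : AEStronglyMeasurable (fun q : Fields P k => K q * g (qU q.1, q.2.2.2))
        (Measure.map (fun r : (GaugeField P (k+1) U1 × HiggsField P (k+1)) × (GaugeField P k U1 × (Prev P k × HiggsField P k)) =>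
          ((surfMul (uPrime r.2.1) r.1.1, (r.2.2.1, (r.2.2.2, r.1.2))) : Fields P k))
          (((fieldMeasure P (k+1) U1).prod volume).prod (ν.prod ((prevMeasure P k).prod volume)))) := by
      rw [hΞ.map_eq]
      exact hKg.aestronglyMeasurable
    rw [← hΞ.map_eq, integral_map hΞ.measurable.aemeasurable hm]
    refine integral_congr_ae (ae_of_all _ fun r => ?_)
    show K (surfMul (uPrime r.2.1) r.1.1, (r.2.2.1, (r.2.2.2, r.1.2))) * g (qU (surfMul (uPrime r.2.1) r.1.1), r.1.2) = _
    rw [qU_surfMul_uPrime hk]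
  rw [lhs, pull, integral_prod _ hKΞg, integral_prod _ hKΞg.integral_prod_left]
  refine integral_congr_ae (ae_of_all _ fun v => integral_congr_ae (ae_of_all _ fun ψ => ?_))
  show ∫ q, K (surfMul (uPrime q.1) (v, ψ).1, (q.2.1, (q.2.2, (v, ψ).2))) * g (v, ψ) ∂ν.prod ((prevMeasure P k).prod volume) = _
  rw [integral_mul_const]

/-- **THE DENSITY AFTER THE TRANSLATION (5.3.1) OVER THE WHOLE LATTICE IS AN ORDINARY FIBRE INTEGRAL** — *"it removes the v-field from the
δ-functions"* (p. 280): if `ρ̃` satisfies file 1's display `IsRD ν terms Qu Qφ a ρ` for the printed `Qu` over a substitution-invariant probability law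
`ν` of `u` (`𝒟u δ_{Ax}`, `𝒟u`), with `fieldsMeasure ν`-integrable term integrands, and `ρ̃` is `dv dψ`-integrable, then `dv dψ`-almost everywhere
`ρ̃(v, ψ) = Σ_t ∫ ρ_t({u^{(j)}}, u′(u)·Q^{s*}v, φ, ψ)·gaussWeight a (Q_t({u^{(j)}}, u′(u)·Q^{s*}v, φ)) ψ d(ν ⊗ Π𝒟u^{(j)} ⊗ 𝒟φ)(u, {u^{(j)}}, φ)` (both sides
integrate every bounded measurable test function to the same number: `term_test_eq_transl`; uniqueness gen 5's `ae_eq_of_forall_test`; standing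
range). [cite: BalabanImbrieJaffe1988, (5.3.6) p.280] -/
theorem isRD_ae_eq_transl (hk : k + 1 ≤ P.m + P.K) (hν : ∀ w, ν.map (fun U => surfMul U w) = ν)
    (h : IsRD ν terms qU Qφ a ρ ρL)
    (hρi : ∀ t ∈ terms, Integrable
      (fun q : Fields P k => ρ t q.2.1 q.1 q.2.2.1 q.2.2.2 * (gaussWeight a (Qφ t q.2.1 q.1 q.2.2.1) q.2.2.2 : ℂ)) (fieldsMeasure ν))
    (hi : Integrable (uncurry ρL) ((fieldMeasure P (k+1) U1).prod volume)) :
    uncurry ρL =ᵐ[(fieldMeasure P (k+1) U1).prod volume]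
      uncurry (fun v ψ => ∑ t ∈ terms, ∫ q, ρ t q.2.1 (surfMul (uPrime q.1) v) q.2.2 ψ *
        (gaussWeight a (Qφ t q.2.1 (surfMul (uPrime q.1) v) q.2.2) ψ : ℂ) ∂ν.prod ((prevMeasure P k).prod volume)) := by
  have hΞ := measurePreserving_transl₅ (P := P) (k := k) hk hν
  -- the candidate density, term by term, is `dv dψ`-integrable
  have hD : ∀ t ∈ terms, Integrable (fun z : GaugeField P (k+1) U1 × HiggsField P (k+1) =>
      ∫ q, ρ t q.2.1 (surfMul (uPrime q.1) z.1) q.2.2 z.2 * (gaussWeight a (Qφ t q.2.1 (surfMul (uPrime q.1) z.1) q.2.2) z.2 : ℂ)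
        ∂ν.prod ((prevMeasure P k).prod volume)) ((fieldMeasure P (k+1) U1).prod volume) := by
    intro t ht
    have hKΞ : Integrable (fun r : (GaugeField P (k+1) U1 × HiggsField P (k+1)) × (GaugeField P k U1 × (Prev P k × HiggsField P k)) =>
        ρ t r.2.2.1 (surfMul (uPrime r.2.1) r.1.1) r.2.2.2 r.1.2 *
          (gaussWeight a (Qφ t r.2.2.1 (surfMul (uPrime r.2.1) r.1.1) r.2.2.2) r.1.2 : ℂ))
        (((fieldMeasure P (k+1) U1).prod volume).prod (ν.prod ((prevMeasure P k).prod volume))) :=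
      (hΞ.integrable_comp (hρi t ht).aestronglyMeasurable).2 (hρi t ht)
    exact hKΞ.integral_prod_left
  have hDsum : Integrable (uncurry fun v ψ => ∑ t ∈ terms, ∫ q, ρ t q.2.1 (surfMul (uPrime q.1) v) q.2.2 ψ *
      (gaussWeight a (Qφ t q.2.1 (surfMul (uPrime q.1) v) q.2.2) ψ : ℂ) ∂ν.prod ((prevMeasure P k).prod volume))
      ((fieldMeasure P (k+1) U1).prod volume) := by
    have e : (uncurry fun v ψ => ∑ t ∈ terms, ∫ q, ρ t q.2.1 (surfMul (uPrime q.1) v) q.2.2 ψ *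
        (gaussWeight a (Qφ t q.2.1 (surfMul (uPrime q.1) v) q.2.2) ψ : ℂ) ∂ν.prod ((prevMeasure P k).prod volume)) =
        fun z : GaugeField P (k+1) U1 × HiggsField P (k+1) => ∑ t ∈ terms,
          ∫ q, ρ t q.2.1 (surfMul (uPrime q.1) z.1) q.2.2 z.2 * (gaussWeight a (Qφ t q.2.1 (surfMul (uPrime q.1) z.1) q.2.2) z.2 : ℂ)
            ∂ν.prod ((prevMeasure P k).prod volume) := by
      funext z
      rfl
    rw [e]
    exact integrable_finsetSum terms hD
  refine ae_eq_of_forall_test hi hDsum fun g hg hgC => ?_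
  obtain ⟨C, hC⟩ := hgC
  rw [h g hg ⟨C, hC⟩]
  -- right-hand side: distribute the sum under the `dv dψ`-integral
  have hDg : ∀ t ∈ terms, Integrable (fun z : GaugeField P (k+1) U1 × HiggsField P (k+1) =>
      (∫ q, ρ t q.2.1 (surfMul (uPrime q.1) z.1) q.2.2 z.2 * (gaussWeight a (Qφ t q.2.1 (surfMul (uPrime q.1) z.1) q.2.2) z.2 : ℂ)
        ∂ν.prod ((prevMeasure P k).prod volume)) * g z) ((fieldMeasure P (k+1) U1).prod volume) := fun t ht =>
    (hD t ht).mul_bdd hg.aestronglyMeasurable (Filter.Eventually.of_forall hC)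
  have rhs : ∫ v, ∫ ψ, (∑ t ∈ terms, ∫ q, ρ t q.2.1 (surfMul (uPrime q.1) v) q.2.2 ψ *
        (gaussWeight a (Qφ t q.2.1 (surfMul (uPrime q.1) v) q.2.2) ψ : ℂ) ∂ν.prod ((prevMeasure P k).prod volume)) * g (v, ψ)
        ∂volume ∂fieldMeasure P (k+1) U1 =
      ∑ t ∈ terms, ∫ v, ∫ ψ, (∫ q, ρ t q.2.1 (surfMul (uPrime q.1) v) q.2.2 ψ *
        (gaussWeight a (Qφ t q.2.1 (surfMul (uPrime q.1) v) q.2.2) ψ : ℂ) ∂ν.prod ((prevMeasure P k).prod volume)) * g (v, ψ)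
        ∂volume ∂fieldMeasure P (k+1) U1 := by
    have h1 : ∫ v, ∫ ψ, (∑ t ∈ terms, ∫ q, ρ t q.2.1 (surfMul (uPrime q.1) v) q.2.2 ψ *
        (gaussWeight a (Qφ t q.2.1 (surfMul (uPrime q.1) v) q.2.2) ψ : ℂ) ∂ν.prod ((prevMeasure P k).prod volume)) * g (v, ψ)
        ∂volume ∂fieldMeasure P (k+1) U1 =
        ∫ z, (∑ t ∈ terms, ∫ q, ρ t q.2.1 (surfMul (uPrime q.1) z.1) q.2.2 z.2 *
          (gaussWeight a (Qφ t q.2.1 (surfMul (uPrime q.1) z.1) q.2.2) z.2 : ℂ) ∂ν.prod ((prevMeasure P k).prod volume)) * g z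
          ∂(fieldMeasure P (k+1) U1).prod volume := by
      rw [integral_prod _ (by simpa only [Finset.sum_mul] using integrable_finsetSum terms hDg)]
    rw [h1]
    simp only [Finset.sum_mul]
    rw [integral_finsetSum terms hDg]
    refine Finset.sum_congr rfl fun t ht => ?_
    rw [integral_prod _ (hDg t ht)]
  rw [rhs]
  exact Finset.sum_congr rfl fun t ht => term_test_eq_transl hk hν (hρi t ht) hg hC

/-- **Iterated form**: `ρ̃(v, ψ) = Σ_t ∫ν(du) ∫Π𝒟u^{(j)} ∫𝒟φ ρ_t({u^{(j)}}, u′(u)·Q^{s*}v, φ, ψ)·gaussWeight a (Q_t(…)) ψ` for `dv dψ`-a.e. `(v, ψ)` (the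
fibre integrand is integrable for a.e. `(v, ψ)`, where the three-fold Fubini applies). [cite: BalabanImbrieJaffe1988, (5.3.6) p.280] -/
theorem isRD_ae_eq_transl_iter (hk : k + 1 ≤ P.m + P.K) (hν : ∀ w, ν.map (fun U => surfMul U w) = ν)
    (h : IsRD ν terms qU Qφ a ρ ρL)
    (hρi : ∀ t ∈ terms, Integrable
      (fun q : Fields P k => ρ t q.2.1 q.1 q.2.2.1 q.2.2.2 * (gaussWeight a (Qφ t q.2.1 q.1 q.2.2.1) q.2.2.2 : ℂ)) (fieldsMeasure ν))
    (hi : Integrable (uncurry ρL) ((fieldMeasure P (k+1) U1).prod volume)) :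
    uncurry ρL =ᵐ[(fieldMeasure P (k+1) U1).prod volume]
      uncurry (fun v ψ => ∑ t ∈ terms, ∫ U, ∫ prev, ∫ φ, ρ t prev (surfMul (uPrime U) v) φ ψ *
        (gaussWeight a (Qφ t prev (surfMul (uPrime U) v) φ) ψ : ℂ) ∂volume ∂prevMeasure P k ∂ν) := by
  have hΞ := measurePreserving_transl₅ (P := P) (k := k) hk hν
  -- for a.e. `(v, ψ)` every fibre integrand is integrable
  have hae : ∀ t ∈ terms, ∀ᵐ z : GaugeField P (k+1) U1 × HiggsField P (k+1) ∂(fieldMeasure P (k+1) U1).prod volume,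
      Integrable (fun q : GaugeField P k U1 × (Prev P k × HiggsField P k) =>
        ρ t q.2.1 (surfMul (uPrime q.1) z.1) q.2.2 z.2 * (gaussWeight a (Qφ t q.2.1 (surfMul (uPrime q.1) z.1) q.2.2) z.2 : ℂ))
        (ν.prod ((prevMeasure P k).prod volume)) := by
    intro t ht
    have hKΞ : Integrable (fun r : (GaugeField P (k+1) U1 × HiggsField P (k+1)) × (GaugeField P k U1 × (Prev P k × HiggsField P k)) =>
        ρ t r.2.2.1 (surfMul (uPrime r.2.1) r.1.1) r.2.2.2 r.1.2 *
          (gaussWeight a (Qφ t r.2.2.1 (surfMul (uPrime r.2.1) r.1.1) r.2.2.2) r.1.2 : ℂ))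
        (((fieldMeasure P (k+1) U1).prod volume).prod (ν.prod ((prevMeasure P k).prod volume))) :=
      (hΞ.integrable_comp (hρi t ht).aestronglyMeasurable).2 (hρi t ht)
    exact hKΞ.prod_right_ae
  have hall := (Filter.eventually_all_finset terms).2 hae
  filter_upwards [isRD_ae_eq_transl hk hν h hρi hi, hall] with z hz hiz
  rw [hz]
  show (∑ t ∈ terms, ∫ q, ρ t q.2.1 (surfMul (uPrime q.1) z.1) q.2.2 z.2 *
      (gaussWeight a (Qφ t q.2.1 (surfMul (uPrime q.1) z.1) q.2.2) z.2 : ℂ) ∂ν.prod ((prevMeasure P k).prod volume)) =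
    ∑ t ∈ terms, ∫ U, ∫ prev, ∫ φ, ρ t prev (surfMul (uPrime U) z.1) φ z.2 *
      (gaussWeight a (Qφ t prev (surfMul (uPrime U) z.1) φ) z.2 : ℂ) ∂volume ∂prevMeasure P k ∂ν
  exact Finset.sum_congr rfl fun t ht => integral_prod₃ (hiz t ht)

/-- **Instance `ν = ∫𝒟u δ_{Ax}(u)(·)`** — the first line of (5.9.6) without large-field regions: *"∫du^{(k)}dφ^{(k)} δ_{Ax}(u^{(k)}) … ∫Π_{j<k}du^{(j)}
(…)"* as an honest iterated integral for the density, `dv dψ`-a.e. (gen 7's `axialMeasure_map_surfMul`). [cite: BalabanImbrieJaffe1988, (5.9.6) p.297] -/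
theorem isRD_axial_ae_eq_transl_iter (hk : k + 1 ≤ P.m + P.K) (h : IsRD (axialMeasure P k U1) terms qU Qφ a ρ ρL)
    (hρi : ∀ t ∈ terms, Integrable
      (fun q : Fields P k => ρ t q.2.1 q.1 q.2.2.1 q.2.2.2 * (gaussWeight a (Qφ t q.2.1 q.1 q.2.2.1) q.2.2.2 : ℂ))
      (fieldsMeasure (axialMeasure P k U1)))
    (hi : Integrable (uncurry ρL) ((fieldMeasure P (k+1) U1).prod volume)) :
    uncurry ρL =ᵐ[(fieldMeasure P (k+1) U1).prod volume]
      uncurry (fun v ψ => ∑ t ∈ terms, ∫ U, ∫ prev, ∫ φ, ρ t prev (surfMul (uPrime U) v) φ ψ *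
        (gaussWeight a (Qφ t prev (surfMul (uPrime U) v) φ) ψ : ℂ) ∂volume ∂prevMeasure P k ∂axialMeasure P k U1) :=
  isRD_ae_eq_transl_iter hk axialMeasure_map_surfMul h hρi hi

/-- **Instance `ν = 𝒟u`** (r18's `map_surfMul_fieldMeasure`). [cite: BalabanImbrieJaffe1988, (5.3.6) p.280] -/
theorem isRD_field_ae_eq_transl_iter (hk : k + 1 ≤ P.m + P.K) (h : IsRD (fieldMeasure P k U1) terms qU Qφ a ρ ρL)
    (hρi : ∀ t ∈ terms, Integrable
      (fun q : Fields P k => ρ t q.2.1 q.1 q.2.2.1 q.2.2.2 * (gaussWeight a (Qφ t q.2.1 q.1 q.2.2.1) q.2.2.2 : ℂ))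
      (fieldsMeasure (fieldMeasure P k U1)))
    (hi : Integrable (uncurry ρL) ((fieldMeasure P (k+1) U1).prod volume)) :
    uncurry ρL =ᵐ[(fieldMeasure P (k+1) U1).prod volume]
      uncurry (fun v ψ => ∑ t ∈ terms, ∫ U, ∫ prev, ∫ φ, ρ t prev (surfMul (uPrime U) v) φ ψ *
        (gaussWeight a (Qφ t prev (surfMul (uPrime U) v) φ) ψ : ℂ) ∂volume ∂prevMeasure P k ∂fieldMeasure P k U1) :=
  isRD_ae_eq_transl_iter hk map_surfMul_fieldMeasure h hρi hi

end Transl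

/-! ## §3 *"in the form of our original induction hypothesis, (4.1)"* at level `k + 1` (no large fields) -/

section Form41

variable {ι : Type*} {terms : Finset ι}
variable {Qφ : ι → Prev P k → GaugeField P k U1 → HiggsField P k → HiggsField P (k+1)} {a : ℝ}
variable {ρ : ι → Prev P k → GaugeField P k U1 → HiggsField P k → HiggsField P (k+1) → ℂ}
variable {ρL : GaugeField P (k+1) U1 → HiggsField P (k+1) → ℂ}

/-- kernel: the fibre integral over `𝒟u ⊗ (Π_{j<k}𝒟u^{(j)} ⊗ 𝒟φ)` of an integrable `G` is the integral over `Π_{j≤k}𝒟u^{(j)}` (r18's `prevMeasure P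
(k+1)`, `u = u^{(k)}` the last previous field) of the `𝒟φ`-integral (re-association, Fubini, the measure-preserving `Fin.snoc`).
[cite: BalabanImbrieJaffe1988, (4.1) p.274] -/
theorem integral_triple_eq_prevMeasure_succ {E : Type*} [NormedAddCommGroup E] [NormedSpace ℝ E]
    {G : GaugeField P k U1 × (Prev P k × HiggsField P k) → E}
    (hG : Integrable G ((fieldMeasure P k U1).prod ((prevMeasure P k).prod (volume : Measure (HiggsField P k))))) :
    ∫ q, G q ∂(fieldMeasure P k U1).prod ((prevMeasure P k).prod (volume : Measure (HiggsField P k))) =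
      ∫ pp, ∫ φ, G (pp (Fin.last k), (Fin.init pp, φ)) ∂volume ∂prevMeasure P (k+1) := by
  -- both sides are the three-fold iterated integral `∫𝒟u ∫Πprev ∫𝒟φ`
  rw [integral_prod₃ hG]
  -- the `𝒟φ`-integral as an integrable function of the pair `(u, {u^{(j)}})` (re-association + Fubini)
  have hA : MeasurePreserving (MeasurableEquiv.prodAssoc : (GaugeField P k U1 × Prev P k) × HiggsField P k →
      GaugeField P k U1 × (Prev P k × HiggsField P k))
      (((fieldMeasure P k U1).prod (prevMeasure P k)).prod volume) ((fieldMeasure P k U1).prod ((prevMeasure P k).prod volume)) :=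
    measurePreserving_prodAssoc _ _ _
  have hG' : Integrable (fun r : (GaugeField P k U1 × Prev P k) × HiggsField P k => G (r.1.1, (r.1.2, r.2)))
      (((fieldMeasure P k U1).prod (prevMeasure P k)).prod volume) :=
    (hA.integrable_comp hG.aestronglyMeasurable).2 hG
  have hH : Integrable (fun p : GaugeField P k U1 × Prev P k => ∫ φ, G (p.1, (p.2, φ)) ∂(volume : Measure (HiggsField P k)))
      ((fieldMeasure P k U1).prod (prevMeasure P k)) := hG'.integral_prod_left
  -- the same function on `Prev P (k+1)` through `(last, init)`, the inverse of `Fin.snoc`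
  have hS := (measurePreserving_snoc (P := P) (k := k))
  have hmeas : Measurable fun pp : Prev P (k+1) => ((pp (Fin.last k), Fin.init pp) : GaugeField P k U1 × Prev P k) :=
    (measurable_pi_apply (Fin.last k)).prodMk (measurable_pi_iff.mpr fun j => measurable_pi_apply (Fin.castSucc j))
  have hSe : MeasurePreserving (fun pp : Prev P (k+1) => ((pp (Fin.last k), Fin.init pp) : GaugeField P k U1 × Prev P k))
      (prevMeasure P (k+1)) ((fieldMeasure P k U1).prod (prevMeasure P k)) := by
    refine ⟨hmeas, ?_⟩
    rw [← hS.map_eq, Measure.map_map hmeas hS.measurable]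
    have hid : ((fun pp : Prev P (k+1) => ((pp (Fin.last k), Fin.init pp) : GaugeField P k U1 × Prev P k)) ∘
        fun p : GaugeField P k U1 × Prev P k => (Fin.snoc p.2 p.1 : Prev P (k+1))) = id := by
      funext p
      simp only [Function.comp_apply, Fin.snoc_last, Fin.init_snoc, id_eq]
    rw [hid, Measure.map_id]
  have hF : Integrable (fun pp : Prev P (k+1) => ∫ φ, G (pp (Fin.last k), (Fin.init pp, φ)) ∂(volume : Measure (HiggsField P k)))
      (prevMeasure P (k+1)) :=
    (hSe.integrable_comp hH.aestronglyMeasurable).2 hH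
  rw [integral_prevMeasure_succ hF]
  simp only [Fin.snoc_last, Fin.init_snoc]

/-- **THE RENORMALIZED DENSITY IS OF THE INDUCTIVE FORM (4.1) AT LEVEL `k + 1`** (pp. 313–314: *"which is in the form of our original induction
hypothesis, (4.1)"*; no large-field regions): for `ν = 𝒟u`, every `dv dψ`-integrable `ρ̃` satisfying the display `IsRD 𝒟u terms Qu Qφ a ρ` (printed
`Qu`, integrable term integrands) is `dv dψ`-a.e. `ρ̃(v, ψ) = Σ_t ∫_{Π_{j≤k}𝒟u^{(j)}} ρ′_{k+1,t}({u^{(j)}}_{j≤k}; v, ψ)` with `ρ′_{k+1,t}({u^{(j)}}_{j≤k}; v, ψ) =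
∫𝒟φ^{(k)} ρ_t({u^{(j)}}_{j<k}, u^{(k)′}·Q^{s*}v, φ^{(k)}, ψ)·gaussWeight a (Q_t({u^{(j)}}_{j<k}, u^{(k)′}·Q^{s*}v, φ^{(k)})) ψ` — the fine field has become
the `k`-th previous field `u^{(k)}` (`{u^{(j)}}_{j<k} = Fin.init`, `u^{(k)} = · (Fin.last k)`), integrated against r18's `prevMeasure P (k+1)`
(standing range). [cite: BalabanImbrieJaffe1988, (4.1) pp.313–314] -/
theorem isRD_field_ae_eq_form41 (hk : k + 1 ≤ P.m + P.K) (h : IsRD (fieldMeasure P k U1) terms qU Qφ a ρ ρL)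
    (hρi : ∀ t ∈ terms, Integrable
      (fun q : Fields P k => ρ t q.2.1 q.1 q.2.2.1 q.2.2.2 * (gaussWeight a (Qφ t q.2.1 q.1 q.2.2.1) q.2.2.2 : ℂ))
      (fieldsMeasure (fieldMeasure P k U1)))
    (hi : Integrable (uncurry ρL) ((fieldMeasure P (k+1) U1).prod volume)) :
    uncurry ρL =ᵐ[(fieldMeasure P (k+1) U1).prod volume]
      uncurry (fun v ψ => ∑ t ∈ terms, ∫ pp, ∫ φ,
        ρ t (Fin.init pp) (surfMul (uPrime (pp (Fin.last k))) v) φ ψ *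
          (gaussWeight a (Qφ t (Fin.init pp) (surfMul (uPrime (pp (Fin.last k))) v) φ) ψ : ℂ) ∂volume ∂prevMeasure P (k+1)) := by
  have hΞ := measurePreserving_transl₅ (P := P) (k := k) (ν := fieldMeasure P k U1) hk map_surfMul_fieldMeasure
  have hae : ∀ t ∈ terms, ∀ᵐ z : GaugeField P (k+1) U1 × HiggsField P (k+1) ∂(fieldMeasure P (k+1) U1).prod volume,
      Integrable (fun q : GaugeField P k U1 × (Prev P k × HiggsField P k) =>
        ρ t q.2.1 (surfMul (uPrime q.1) z.1) q.2.2 z.2 * (gaussWeight a (Qφ t q.2.1 (surfMul (uPrime q.1) z.1) q.2.2) z.2 : ℂ))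
        ((fieldMeasure P k U1).prod ((prevMeasure P k).prod volume)) := by
    intro t ht
    have hKΞ : Integrable (fun r : (GaugeField P (k+1) U1 × HiggsField P (k+1)) × (GaugeField P k U1 × (Prev P k × HiggsField P k)) =>
        ρ t r.2.2.1 (surfMul (uPrime r.2.1) r.1.1) r.2.2.2 r.1.2 *
          (gaussWeight a (Qφ t r.2.2.1 (surfMul (uPrime r.2.1) r.1.1) r.2.2.2) r.1.2 : ℂ))
        (((fieldMeasure P (k+1) U1).prod volume).prod ((fieldMeasure P k U1).prod ((prevMeasure P k).prod volume))) :=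
      (hΞ.integrable_comp (hρi t ht).aestronglyMeasurable).2 (hρi t ht)
    exact hKΞ.prod_right_ae
  have hall := (Filter.eventually_all_finset terms).2 hae
  filter_upwards [isRD_ae_eq_transl hk map_surfMul_fieldMeasure h hρi hi, hall] with z hz hiz
  rw [hz]
  show (∑ t ∈ terms, ∫ q, ρ t q.2.1 (surfMul (uPrime q.1) z.1) q.2.2 z.2 *
      (gaussWeight a (Qφ t q.2.1 (surfMul (uPrime q.1) z.1) q.2.2) z.2 : ℂ) ∂(fieldMeasure P k U1).prod ((prevMeasure P k).prod volume)) =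
    ∑ t ∈ terms, ∫ pp, ∫ φ, ρ t (Fin.init pp) (surfMul (uPrime (pp (Fin.last k))) z.1) φ z.2 *
      (gaussWeight a (Qφ t (Fin.init pp) (surfMul (uPrime (pp (Fin.last k))) z.1) φ) z.2 : ℂ) ∂volume ∂prevMeasure P (k+1)
  exact Finset.sum_congr rfl fun t ht => integral_triple_eq_prevMeasure_succ (hiz t ht)

end Form41

end

end Literature.MathematicalPhysics.QuantumFieldTheory.BalabanImbrieJaffe1984to88.BIJ88RT53DensityForm
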